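import Literature.NumberTheory.LFunctions.WeilArchDensityMoments
import HarnessLib

/-!
# Motivic door, semi-local ladder — sharp (Padé) two-sided enclosures of the archimedean density moments

Cell `rh-explicit` (seat cc-s2-2), workstream CC-M2 (the `{∞,2}` threshold `weilSemilocalThreshold {2}` pinned from
above by EXACT-evaluation negative certificates).  Honest framing: a quantitative theorem about Connes' semi-local Weil
functional at `S = {∞, 2}`; not a case of RH; nothing here bears on RH itself.

Sequel of `Literature/NumberTheory/LFunctions/WeilArchDensityMoments.lean`.  There the remainder of the finite exponential
split `ρ(t) = Σ_{m<M} e^{−(2m+½)t} + ρ_M(t)`, `ρ_M(t) = e^{−(2M+½)t}/(1 − e^{−2t})` (`weilArchDensity_eq_sum_add_rem`) is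
bounded by `0 ≤ ρ_M ≤ e^{−(2M+½)t}(1 + 1/(2t))`, which costs `O(1/M)` in the LOWER bound of the first moment `∫_0^L t ρ(t) dt`
and `O(M^{-n})` in the others.  Here the elementary Padé bounds

  `1/x + 1/2 ≤ 1/(1 − e^{−x}) ≤ 1/x + 1/2 + x/12`     (`x > 0`; `one_div_one_sub_exp_neg_ge`, `one_div_one_sub_exp_neg_le`)

(the `(1,1)` and `(2,2)` Padé approximants of `e^{−x}` are a lower, resp. an upper bound of `e^{−x}` on `x ≥ 0`) give

  `e^{−(2M+½)t}(1/(2t) + 1/2) ≤ ρ_M(t) ≤ e^{−(2M+½)t}(1/(2t) + 1/2 + t/6)`     (`t > 0`),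

hence for `n = k+1 ≥ 1`, `L > 0`, with `I_j(a) := ∫_0^L t^j e^{−at} dt` (closed form `integral_pow_mul_exp_neg_mul`), `a_M = 2M+½`:

  `Σ_{m<M} I_n(a_m) + ½ I_k(a_M) + ½ I_n(a_M) ≤ ∫_{(0,L]} t^n ρ(t) dt ≤ Σ_{m<M} I_n(a_m) + ½ I_k(a_M) + ½ I_n(a_M) + ⅙ I_{n+1}(a_M)`

(`setIntegral_pow_mul_weilArchDensity_ge_sharp`, `…_le_sharp`): a two-sided enclosure of every ρ-moment whose width
`⅙ I_{n+1}(a_M) ≤ (n+1)!/(6 a_M^{n+2})` is `O(M^{−n−2})` — the form needed to certify the archimedean energy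
`∫_0^{2b} ρ(t) D(t) dt = Σ_n d_n ∫_0^{2b} t^n ρ` of a polynomial × window Markov witness when the coefficients `d_n` have BOTH
signs.  All proved (sorry-free, axioms propext / Classical.choice / Quot.sound); no named facts; no definitions of
mathematical objects.

## References
* E. Bombieri, *Remarks on Weil's quadratic functional in the theory of prime numbers I*, Rend. Mat. Acc. Lincei (9) 11
  (2000) 183–233, Thm 2 (the density `x dx/(x² − 1)`, `x = e^t`, i.e. `e^{t/2}/(2 sinh t)`). [Bombieri2000Weil]
* Padé approximants of the exponential: `(2−x)/(2+x) ≤ e^{−x} ≤ (12−6x+x²)/(12+6x+x²)` for `x ≥ 0` (classical).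
-/

set_option linter.dupNamespace false

noncomputable section

open Real Set MeasureTheory Finset intervalIntegral
open scoped BigOperators Topology

namespace Summit.RiemannHypothesis.RiemannHypothesis.Theorems.MotivicDoor.SemilocalArchMoments

open Literature.NumberTheory.LFunctions

/-! ## A monotonicity step -/

/-- If `g(0) = 0` and `g′ ≥ 0` on `(0, ∞)` then `g ≥ 0` on `[0, ∞)`. [folklore] -/
theorem nonneg_of_hasDerivAt_nonneg {g g' : ℝ → ℝ} (hg : ∀ y, HasDerivAt g (g' y) y) (hg0 : g 0 = 0)
    (hpos : ∀ y, 0 < y → 0 ≤ g' y) {y : ℝ} (hy : 0 ≤ y) : 0 ≤ g y := by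
  have hmono : MonotoneOn g (Ici 0) := by
    refine monotoneOn_of_deriv_nonneg (convex_Ici 0) ?_ ?_ ?_
    · exact fun z _ ↦ (hg z).continuousAt.continuousWithinAt
    · exact fun z _ ↦ (hg z).differentiableAt.differentiableWithinAt
    · intro z hz
      rw [interior_Ici, Set.mem_Ioi] at hz
      rw [(hg z).deriv]
      exact hpos z hz
  have := hmono (self_mem_Ici) (mem_Ici.2 hy) hy
  rwa [hg0] at this

/-! ## Padé bounds for the exponential and for `1/(1 − e^{−x})` -/

/-- `(2 − x) ≤ (2 + x) e^{−x}` for `x ≥ 0` (the `(1,1)` Padé approximant of `e^{−x}` is a lower bound).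
Proof: `f(x) = (2+x)e^{−x} − (2−x)` has `f(0) = 0` and `f′(x) = 1 − (1+x)e^{−x} ≥ 0` (`1 + x ≤ e^x`). [folklore] -/
theorem two_sub_le_two_add_mul_exp_neg {x : ℝ} (hx : 0 ≤ x) : 2 - x ≤ (2 + x) * Real.exp (-x) := by
  have hf' : ∀ y : ℝ, HasDerivAt (fun y : ℝ ↦ (2 + y) * Real.exp (-y) - (2 - y)) (1 - (1 + y) * Real.exp (-y)) y := by
    intro y
    have h1 : HasDerivAt (fun y : ℝ ↦ (2 + y) * Real.exp (-y))
        (1 * Real.exp (-y) + (2 + y) * (Real.exp (-y) * (-1))) y :=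
      ((hasDerivAt_id' y).const_add 2).mul (hasDerivAt_neg' y).exp
    have h2 : HasDerivAt (fun y : ℝ ↦ (2 : ℝ) - y) (-1) y := (hasDerivAt_id' y).const_sub 2
    exact (h1.sub h2).congr_deriv (by ring)
  have h := nonneg_of_hasDerivAt_nonneg hf' (by norm_num) ?_ hx
  · linarith
  · intro y hy
    have hexp : 1 + y ≤ Real.exp y := by linarith [Real.add_one_le_exp y]
    have hpos : 0 < Real.exp y := Real.exp_pos y
    have hprod : (1 + y) * Real.exp (-y) ≤ 1 := by
      rw [Real.exp_neg, ← div_eq_mul_inv, div_le_one hpos]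
      exact hexp
    linarith

/-- `(12 + 6x + x²) ≤ (12 − 6x + x²) e^{x}` for `x ≥ 0` (the `(2,2)` Padé approximant of `e^{−x}` is an upper bound).
Proof: `h(x) = (12−6x+x²)eˣ − (12+6x+x²)` has `h(0) = h′(0) = h″(0) = 0` and `h‴(x) = x² eˣ ≥ 0`. [folklore] -/
theorem pade22_le_mul_exp {x : ℝ} (hx : 0 ≤ x) :
    12 + 6 * x + x ^ 2 ≤ (12 - 6 * x + x ^ 2) * Real.exp x := by
  -- h'' (y) = (2 - 2y + y²) eʸ − 2, derivative y² eʸ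
  have hd2 : ∀ y : ℝ, HasDerivAt (fun y : ℝ ↦ (2 - 2 * y + y ^ 2) * Real.exp y - 2) (y ^ 2 * Real.exp y) y := by
    intro y
    have hp : HasDerivAt (fun y : ℝ ↦ 2 - 2 * y + y ^ 2) (-(2 * 1) + (2 : ℕ) * y ^ (2 - 1)) y :=
      (((hasDerivAt_id' y).const_mul 2).const_sub 2).add (hasDerivAt_pow 2 y)
    have h := (hp.mul (Real.hasDerivAt_exp y)).sub_const 2
    exact h.congr_deriv (by push_cast; ring)
  have h2nn : ∀ y : ℝ, 0 < y → 0 ≤ (2 - 2 * y + y ^ 2) * Real.exp y - 2 := fun y hy ↦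
    nonneg_of_hasDerivAt_nonneg hd2 (by norm_num) (fun z _ ↦ by positivity) hy.le
  -- h' (y) = (6 - 4y + y²) eʸ − 6 − 2y, derivative h''
  have hd1 : ∀ y : ℝ, HasDerivAt (fun y : ℝ ↦ (6 - 4 * y + y ^ 2) * Real.exp y - 6 - 2 * y)
      ((2 - 2 * y + y ^ 2) * Real.exp y - 2) y := by
    intro y
    have hp : HasDerivAt (fun y : ℝ ↦ 6 - 4 * y + y ^ 2) (-(4 * 1) + (2 : ℕ) * y ^ (2 - 1)) y :=
      (((hasDerivAt_id' y).const_mul 4).const_sub 6).add (hasDerivAt_pow 2 y)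
    have h := ((hp.mul (Real.hasDerivAt_exp y)).sub_const 6).sub ((hasDerivAt_id' y).const_mul 2)
    exact h.congr_deriv (by push_cast; ring)
  have h1nn : ∀ y : ℝ, 0 < y → 0 ≤ (6 - 4 * y + y ^ 2) * Real.exp y - 6 - 2 * y := fun y hy ↦
    nonneg_of_hasDerivAt_nonneg hd1 (by norm_num) h2nn hy.le
  -- h (y) = (12 - 6y + y²) eʸ − (12 + 6y + y²), derivative h'
  have hd0 : ∀ y : ℝ, HasDerivAt (fun y : ℝ ↦ (12 - 6 * y + y ^ 2) * Real.exp y - (12 + 6 * y + y ^ 2))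
      ((6 - 4 * y + y ^ 2) * Real.exp y - 6 - 2 * y) y := by
    intro y
    have hp : HasDerivAt (fun y : ℝ ↦ 12 - 6 * y + y ^ 2) (-(6 * 1) + (2 : ℕ) * y ^ (2 - 1)) y :=
      (((hasDerivAt_id' y).const_mul 6).const_sub 12).add (hasDerivAt_pow 2 y)
    have hq : HasDerivAt (fun y : ℝ ↦ 12 + 6 * y + y ^ 2) (6 * 1 + (2 : ℕ) * y ^ (2 - 1)) y :=
      (((hasDerivAt_id' y).const_mul 6).const_add 12).add (hasDerivAt_pow 2 y)
    have h := (hp.mul (Real.hasDerivAt_exp y)).sub hq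
    exact h.congr_deriv (by push_cast; ring)
  have h0nn : 0 ≤ (12 - 6 * x + x ^ 2) * Real.exp x - (12 + 6 * x + x ^ 2) :=
    nonneg_of_hasDerivAt_nonneg hd0 (by norm_num) h1nn hx
  linarith

/-- **Lower Padé bound**: `1/x + 1/2 ≤ 1/(1 − e^{−x})` for `x > 0`. [folklore] -/
theorem one_div_one_sub_exp_neg_ge {x : ℝ} (hx : 0 < x) :
    1 / x + 1 / 2 ≤ 1 / (1 - Real.exp (-x)) := by
  have hq1 : Real.exp (-x) < 1 := Real.exp_lt_one_iff.2 (by linarith)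
  have hden : 0 < 1 - Real.exp (-x) := by linarith
  have hkey := two_sub_le_two_add_mul_exp_neg hx.le
  rw [show 1 / x + 1 / 2 = (2 + x) / (2 * x) by field_simp, div_le_div_iff₀ (by positivity) hden]
  nlinarith [Real.exp_pos (-x)]

/-- **Upper Padé bound**: `1/(1 − e^{−x}) ≤ 1/x + 1/2 + x/12` for `x > 0`. [folklore] -/
theorem one_div_one_sub_exp_neg_le {x : ℝ} (hx : 0 < x) :
    1 / (1 - Real.exp (-x)) ≤ 1 / x + 1 / 2 + x / 12 := by
  have hq1 : Real.exp (-x) < 1 := Real.exp_lt_one_iff.2 (by linarith)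
  have hden : 0 < 1 - Real.exp (-x) := by linarith
  have hkey := pade22_le_mul_exp hx.le
  have hinv : Real.exp x * Real.exp (-x) = 1 := by rw [← Real.exp_add]; simp
  have h3 : (12 + 6 * x + x ^ 2) * Real.exp (-x) ≤ 12 - 6 * x + x ^ 2 := by
    have := mul_le_mul_of_nonneg_right hkey (Real.exp_pos (-x)).le
    calc (12 + 6 * x + x ^ 2) * Real.exp (-x) ≤ (12 - 6 * x + x ^ 2) * Real.exp x * Real.exp (-x) := this
      _ = 12 - 6 * x + x ^ 2 := by rw [mul_assoc, hinv, mul_one]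
  rw [show 1 / x + 1 / 2 + x / 12 = (12 + 6 * x + x ^ 2) / (12 * x) by field_simp; ring,
    div_le_div_iff₀ hden (by positivity)]
  nlinarith

/-! ## The sharp two-sided bound of the remainder `ρ_M` -/

/-- `ρ_M(t) ≥ e^{−(2M+½)t}(1/(2t) + 1/2)` for `t > 0`. [folklore] -/
theorem weilArchDensityRem_ge_sharp {t : ℝ} (ht : 0 < t) (M : ℕ) :
    Real.exp (-((2 * M + 1 / 2) * t)) * (1 / (2 * t) + 1 / 2) ≤ weilArchDensityRem M t := by
  unfold weilArchDensityRem
  have h := one_div_one_sub_exp_neg_ge (x := 2 * t) (by linarith)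
  calc Real.exp (-((2 * M + 1 / 2) * t)) * (1 / (2 * t) + 1 / 2)
      ≤ Real.exp (-((2 * M + 1 / 2) * t)) * (1 / (1 - Real.exp (-(2 * t)))) :=
        mul_le_mul_of_nonneg_left h (Real.exp_pos _).le
    _ = Real.exp (-((2 * M + 1 / 2) * t)) / (1 - Real.exp (-(2 * t))) := by rw [mul_one_div]

/-- `ρ_M(t) ≤ e^{−(2M+½)t}(1/(2t) + 1/2 + t/6)` for `t > 0`. [folklore] -/
theorem weilArchDensityRem_le_sharp {t : ℝ} (ht : 0 < t) (M : ℕ) :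
    weilArchDensityRem M t ≤ Real.exp (-((2 * M + 1 / 2) * t)) * (1 / (2 * t) + 1 / 2 + t / 6) := by
  unfold weilArchDensityRem
  have h := one_div_one_sub_exp_neg_le (x := 2 * t) (by linarith)
  have e : 2 * t / 12 = t / 6 := by ring
  rw [e] at h
  calc Real.exp (-((2 * M + 1 / 2) * t)) / (1 - Real.exp (-(2 * t)))
      = Real.exp (-((2 * M + 1 / 2) * t)) * (1 / (1 - Real.exp (-(2 * t)))) := by rw [mul_one_div]
    _ ≤ Real.exp (-((2 * M + 1 / 2) * t)) * (1 / (2 * t) + 1 / 2 + t / 6) :=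
        mul_le_mul_of_nonneg_left h (Real.exp_pos _).le

/-! ## Two-sided sharp enclosure of the ρ-moments -/

/-- **Sharp lower bound of the ρ-moments**: for `0 < L`, every `k` and `M`, with `n = k+1 ≥ 1`:
`Σ_{m<M} I_n(2m+½) + ½ I_k(2M+½) + ½ I_n(2M+½) ≤ ∫_{(0,L]} t^n ρ(t) dt`, `I_j(a) = ∫_0^L t^j e^{−at}dt`. [folklore] -/
theorem setIntegral_pow_mul_weilArchDensity_ge_sharp (k : ℕ) {L : ℝ} (hL : 0 < L) (M : ℕ)
    (hint : IntegrableOn (fun t : ℝ ↦ t ^ (k + 1) * weilArchDensity t) (Ioc 0 L)) :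
    (∑ m ∈ Finset.range M, ∫ t in (0 : ℝ)..L, t ^ (k + 1) * Real.exp (-((2 * m + 1 / 2) * t))) +
        1 / 2 * (∫ t in (0 : ℝ)..L, t ^ k * Real.exp (-((2 * M + 1 / 2) * t))) +
        1 / 2 * (∫ t in (0 : ℝ)..L, t ^ (k + 1) * Real.exp (-((2 * M + 1 / 2) * t))) ≤
      ∫ t in Ioc 0 L, t ^ (k + 1) * weilArchDensity t := by
  set g : ℝ → ℝ := fun t ↦ (∑ m ∈ Finset.range M, t ^ (k + 1) * Real.exp (-((2 * (m : ℝ) + 1 / 2) * t))) +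
      1 / 2 * (t ^ k * Real.exp (-((2 * (M : ℝ) + 1 / 2) * t))) +
      1 / 2 * (t ^ (k + 1) * Real.exp (-((2 * (M : ℝ) + 1 / 2) * t))) with hg
  have hgc : Continuous g := by rw [hg]; fun_prop
  have hgi : IntegrableOn g (Ioc 0 L) := (hgc.integrableOn_Icc).mono_set Ioc_subset_Icc_self
  have hle : ∀ t ∈ Ioc (0 : ℝ) L, g t ≤ t ^ (k + 1) * weilArchDensity t := by
    intro t ht
    have ht0 : 0 < t := ht.1
    have htn : 0 ≤ t ^ (k + 1) := pow_nonneg ht0.le _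
    rw [weilArchDensity_eq_sum_add_rem ht0 M, mul_add, hg]
    simp only
    have hrem := weilArchDensityRem_ge_sharp ht0 M
    have h1 : 1 / 2 * (t ^ k * Real.exp (-((2 * (M : ℝ) + 1 / 2) * t))) +
        1 / 2 * (t ^ (k + 1) * Real.exp (-((2 * (M : ℝ) + 1 / 2) * t))) ≤ t ^ (k + 1) * weilArchDensityRem M t := by
      have hid : 1 / 2 * (t ^ k * Real.exp (-((2 * (M : ℝ) + 1 / 2) * t))) +
          1 / 2 * (t ^ (k + 1) * Real.exp (-((2 * (M : ℝ) + 1 / 2) * t))) =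
          t ^ (k + 1) * (Real.exp (-((2 * (M : ℝ) + 1 / 2) * t)) * (1 / (2 * t) + 1 / 2)) := by
        rw [pow_succ]
        field_simp
      rw [hid]
      exact mul_le_mul_of_nonneg_left hrem htn
    rw [Finset.mul_sum]
    linarith
  calc (∑ m ∈ Finset.range M, ∫ t in (0 : ℝ)..L, t ^ (k + 1) * Real.exp (-((2 * m + 1 / 2) * t))) +
        1 / 2 * (∫ t in (0 : ℝ)..L, t ^ k * Real.exp (-((2 * M + 1 / 2) * t))) +
        1 / 2 * (∫ t in (0 : ℝ)..L, t ^ (k + 1) * Real.exp (-((2 * M + 1 / 2) * t)))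
      = ∫ t in Ioc 0 L, g t := by
        rw [← intervalIntegral.integral_of_le hL.le, hg]
        simp only
        rw [intervalIntegral.integral_add, intervalIntegral.integral_add, intervalIntegral.integral_const_mul,
          intervalIntegral.integral_const_mul, intervalIntegral.integral_finsetSum]
        · intro m _; exact intervalIntegrable_pow_mul_exp (k + 1) _ L
        · exact (by fun_prop : Continuous fun t : ℝ ↦ ∑ m ∈ Finset.range M, t ^ (k + 1) * Real.exp (-((2 * (m : ℝ) + 1 / 2) * t))).intervalIntegrable _ _
        · exact (intervalIntegrable_pow_mul_exp k _ L).const_mul _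
        · exact ((by fun_prop : Continuous fun t : ℝ ↦ ∑ m ∈ Finset.range M, t ^ (k + 1) * Real.exp (-((2 * (m : ℝ) + 1 / 2) * t))).intervalIntegrable _ _).add
            ((intervalIntegrable_pow_mul_exp k _ L).const_mul _)
        · exact (intervalIntegrable_pow_mul_exp (k + 1) _ L).const_mul _
    _ ≤ ∫ t in Ioc 0 L, t ^ (k + 1) * weilArchDensity t := setIntegral_mono_on hgi hint measurableSet_Ioc hle

/-- **Sharp upper bound of the ρ-moments**: for `0 < L`, every `k` and `M`, with `n = k+1 ≥ 1`:
`∫_{(0,L]} t^n ρ(t) dt ≤ Σ_{m<M} I_n(2m+½) + ½ I_k(2M+½) + ½ I_n(2M+½) + ⅙ I_{n+1}(2M+½)`. [folklore] -/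
theorem setIntegral_pow_mul_weilArchDensity_le_sharp (k : ℕ) {L : ℝ} (hL : 0 < L) (M : ℕ)
    (hint : IntegrableOn (fun t : ℝ ↦ t ^ (k + 1) * weilArchDensity t) (Ioc 0 L)) :
    ∫ t in Ioc 0 L, t ^ (k + 1) * weilArchDensity t ≤
      (∑ m ∈ Finset.range M, ∫ t in (0 : ℝ)..L, t ^ (k + 1) * Real.exp (-((2 * m + 1 / 2) * t))) +
        1 / 2 * (∫ t in (0 : ℝ)..L, t ^ k * Real.exp (-((2 * M + 1 / 2) * t))) +
        1 / 2 * (∫ t in (0 : ℝ)..L, t ^ (k + 1) * Real.exp (-((2 * M + 1 / 2) * t))) +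
        1 / 6 * (∫ t in (0 : ℝ)..L, t ^ (k + 2) * Real.exp (-((2 * M + 1 / 2) * t))) := by
  set g : ℝ → ℝ := fun t ↦ (∑ m ∈ Finset.range M, t ^ (k + 1) * Real.exp (-((2 * (m : ℝ) + 1 / 2) * t))) +
      1 / 2 * (t ^ k * Real.exp (-((2 * (M : ℝ) + 1 / 2) * t))) +
      1 / 2 * (t ^ (k + 1) * Real.exp (-((2 * (M : ℝ) + 1 / 2) * t))) +
      1 / 6 * (t ^ (k + 2) * Real.exp (-((2 * (M : ℝ) + 1 / 2) * t))) with hg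
  have hgc : Continuous g := by rw [hg]; fun_prop
  have hgi : IntegrableOn g (Ioc 0 L) := (hgc.integrableOn_Icc).mono_set Ioc_subset_Icc_self
  have hle : ∀ t ∈ Ioc (0 : ℝ) L, t ^ (k + 1) * weilArchDensity t ≤ g t := by
    intro t ht
    have ht0 : 0 < t := ht.1
    have htn : 0 ≤ t ^ (k + 1) := pow_nonneg ht0.le _
    rw [weilArchDensity_eq_sum_add_rem ht0 M, mul_add, hg]
    simp only
    have hrem := weilArchDensityRem_le_sharp ht0 M
    have h1 : t ^ (k + 1) * weilArchDensityRem M t ≤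
        1 / 2 * (t ^ k * Real.exp (-((2 * (M : ℝ) + 1 / 2) * t))) +
        1 / 2 * (t ^ (k + 1) * Real.exp (-((2 * (M : ℝ) + 1 / 2) * t))) +
        1 / 6 * (t ^ (k + 2) * Real.exp (-((2 * (M : ℝ) + 1 / 2) * t))) := by
      have hid : 1 / 2 * (t ^ k * Real.exp (-((2 * (M : ℝ) + 1 / 2) * t))) +
          1 / 2 * (t ^ (k + 1) * Real.exp (-((2 * (M : ℝ) + 1 / 2) * t))) +
          1 / 6 * (t ^ (k + 2) * Real.exp (-((2 * (M : ℝ) + 1 / 2) * t))) =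
          t ^ (k + 1) * (Real.exp (-((2 * (M : ℝ) + 1 / 2) * t)) * (1 / (2 * t) + 1 / 2 + t / 6)) := by
        rw [pow_succ, pow_succ]
        field_simp
        ring
      calc t ^ (k + 1) * weilArchDensityRem M t
          ≤ t ^ (k + 1) * (Real.exp (-((2 * (M : ℝ) + 1 / 2) * t)) * (1 / (2 * t) + 1 / 2 + t / 6)) :=
            mul_le_mul_of_nonneg_left hrem htn
        _ = _ := hid.symm
    rw [Finset.mul_sum]
    linarith
  calc ∫ t in Ioc 0 L, t ^ (k + 1) * weilArchDensity t ≤ ∫ t in Ioc 0 L, g t :=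
        setIntegral_mono_on hint hgi measurableSet_Ioc hle
    _ = _ := by
        rw [← intervalIntegral.integral_of_le hL.le, hg]
        simp only
        rw [intervalIntegral.integral_add, intervalIntegral.integral_add, intervalIntegral.integral_add,
          intervalIntegral.integral_const_mul, intervalIntegral.integral_const_mul, intervalIntegral.integral_const_mul,
          intervalIntegral.integral_finsetSum]
        · intro m _; exact intervalIntegrable_pow_mul_exp (k + 1) _ L
        · exact (by fun_prop : Continuous fun t : ℝ ↦ ∑ m ∈ Finset.range M, t ^ (k + 1) * Real.exp (-((2 * (m : ℝ) + 1 / 2) * t))).intervalIntegrable _ _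
        · exact (intervalIntegrable_pow_mul_exp k _ L).const_mul _
        · exact ((by fun_prop : Continuous fun t : ℝ ↦ ∑ m ∈ Finset.range M, t ^ (k + 1) * Real.exp (-((2 * (m : ℝ) + 1 / 2) * t))).intervalIntegrable _ _).add
            ((intervalIntegrable_pow_mul_exp k _ L).const_mul _)
        · exact (intervalIntegrable_pow_mul_exp (k + 1) _ L).const_mul _
        · exact (((by fun_prop : Continuous fun t : ℝ ↦ ∑ m ∈ Finset.range M, t ^ (k + 1) * Real.exp (-((2 * (m : ℝ) + 1 / 2) * t))).intervalIntegrable _ _).add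
            ((intervalIntegrable_pow_mul_exp k _ L).const_mul _)).add ((intervalIntegrable_pow_mul_exp (k + 1) _ L).const_mul _)
        · exact (intervalIntegrable_pow_mul_exp (k + 2) _ L).const_mul _

end Summit.RiemannHypothesis.RiemannHypothesis.Theorems.MotivicDoor.SemilocalArchMoments

end
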